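import Mathlib
import HarnessLib
import Literature.Analysis.FluidPDE.Tao2016AveragedNS.LocalCascadeSolutions
import Literature.Analysis.FluidPDE.Tao2016AveragedNS.RenormalisedCascadeWaves
import Literature.Analysis.FluidPDE.Tao2016AveragedNS.SelfSimilarCascadeBlowup
import Literature.Analysis.FluidPDE.Tao2016AveragedNS.ViscousEternalSolutions
import Literature.Analysis.FluidPDE.Tao2016AveragedNS.BoundedEternalSolutions
import Summits.NavierStokesRegularity.NavierStokesRegularity.Theses.TaoLadderRungTwoBreak
import Summits.NavierStokesRegularity.NavierStokesRegularity.Theorems.WakeRatchetEternalViscousRateHalflineLiouville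
import Summits.NavierStokesRegularity.NavierStokesRegularity.Theorems.TransitMassLedgerActionTransitExtractionSmallAmplitudeRung

/-!
# Rung for the DECIDING crux K1ᵛ(1) `TaoLadderRungTwoBreak.NoSurvivingEternalViscBddOne`
# (stmt-NavierStokesRegularity-20419): the ONE-SIDED classes are settled — a uniformly bounded admissible
# eternal solution (any `ν̂ ≥ 0`) supported on a half-line of shells is not (S_a)-surviving

MODEL lattice ODEs only (Tao 2016 §4 in the variables of §6.4); nothing here is a statement about the
Navier–Stokes equations; no summit or rung LEAF is proved (`--supports stmt-NavierStokesRegularity-20419 --as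
helper`).

Two degenerate sub-classes of the objects K1ᵛ(1) quantifies over, for the record of the repair census:

* UNFED solutions — `W_k ≡ 0` for all shells `k ≤ N` (nothing below some shell; no energy supply from
  `k → -∞`): by the tree's «no one-sided eternal solutions» theorem (`…DissipationEdge.no_oneSided_eternal`,
  route WakeRatchet, ns-idea-1 g9: the finite tail energy above `N` has no incoming flux and decays as
  `σ → -∞`) such a solution of a CANCELLING table vanishes identically, hence is not forward-surviving at any
  exponent (`not_survivingFwd_of_vanish_below`);
* TOP-BOUNDED solutions — `W_k ≡ 0` for all shells `k ≥ N`: forward survival asks for arbitrarily high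
  shells, so it fails trivially (`not_survivingFwd_of_vanish_above`; no dynamics).

Packaged in the crux's quantifier shape (`noSurvivingEternalViscBddOne_unfed`, PROVED for every `ε₀ > 0`,
threshold `εs = 1`; a case of the crux: `unfed_of_noSurvivingEternalViscBddOne`).  READING: the content of
K1ᵛ(1) lives entirely on solutions FED FROM `-∞` and active on arbitrarily high shells — the loud ladders /
surviving fronts of the route file.

HONEST LABEL: bookkeeping over a landed theorem of another route + one triviality; ⟨20419⟩ stays OPEN.
-/

noncomputable section

-- the summit and its single sub-problem share the name (CONVENTIONS §1)
set_option linter.dupNamespace false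

namespace Summit.NavierStokesRegularity.NavierStokesRegularity.Theorems.NoSurvivingEternalViscBddOne.OneSided

open Literature.Analysis.FluidPDE Literature.Analysis.FluidPDE.TaoCascade
open Summit.NavierStokesRegularity.NavierStokesRegularity.Theses.TaoLadderRungTwoBreak
open Summit.NavierStokesRegularity.NavierStokesRegularity.Cruxes.ActionTransitExtraction.SmallAmplitudeRung
  (not_survivingFwd_of_eq_zero)

variable {ε₀ νh a : ℝ} {α : Fin 4 → Fin 4 → Fin 4 → ℤ × ℤ × ℤ → ℝ} {W : ℤ → ℝ → Em 4}

/-- **UNFED bounded eternal solutions are not surviving (they are zero).**  On a table of `InTableClass R`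
(cancelling), a uniformly bounded admissible eternal solution with covariant viscosity `ν̂ ≥ 0` that vanishes
on all shells `k ≤ N` vanishes identically (tree `no_oneSided_eternal`), hence is not forward-(S_a)-surviving.
[cite: Tao2016AveragedNS, §4 Lemma 4.1 (4.8)–(4.10), §6.4; tree: WakeRatchet `no_oneSided_eternal`] -/
theorem not_survivingFwd_of_vanish_below {R : ℝ} (hε : 0 < ε₀) (hα : InTableClass R α)
    (hW : IsEternalVisc ε₀ νh α W) (hU : UniformBound W) {N : ℤ}
    (hz : ∀ k : ℤ, k ≤ N → ∀ σ : ℝ, W k σ = 0) : ¬ EternalSurvivingFwd a ε₀ W := by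
  have hW0 : W = fun _ _ => 0 :=
    Summit.NavierStokesRegularity.NavierStokesRegularity.Cruxes.EternalViscousRate.DissipationEdge.no_oneSided_eternal
      hε hW hα.2.1 hU hz
  exact not_survivingFwd_of_eq_zero a ε₀ fun k σ => by rw [hW0]

/-- **TOP-BOUNDED families are not surviving** (no dynamics): if `W_k ≡ 0` for all `k ≥ N`, forward
survival — which asks for arbitrarily high shells carrying weighted energy `≥ c > 0` — fails.
[cite: Tao2016AveragedNS, §4 (the `a`-weighted shell energy), §6.4; cell vocabulary] -/
theorem not_survivingFwd_of_vanish_above {N : ℤ} (hz : ∀ k : ℤ, N ≤ k → ∀ σ : ℝ, W k σ = 0) :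
    ¬ EternalSurvivingFwd a ε₀ W := by
  rintro ⟨c, hc, H⟩
  obtain ⟨n, hNn, σ, -, hle⟩ := H N.toNat
  have hn : N ≤ (n : ℤ) := (Int.self_le_toNat N).trans (by exact_mod_cast hNn)
  rw [hz n hn σ, norm_zero] at hle
  have : physWeight a ε₀ ^ n * (Real.exp (2 * σ) * (0 : ℝ) ^ 2) = 0 := by ring
  linarith

/-- **K1ᵛ(1)-RUNG (unfed class), PROVED** (every spread, threshold `εs = 1`, in fact every `ε₀ > 0`): no
E₂(R) table carries a uniformly bounded admissible eternal solution with covariant viscosity `ν̂ ≥ 0` that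
vanishes on all shells below some `N` and is (S₁)-surviving forward.
[cite: Tao2016AveragedNS, §4 Thm. 4.2 (statement shape), §6.4; cell vocabulary] -/
theorem noSurvivingEternalViscBddOne_unfed :
    ∀ R : ℝ, 1 ≤ R → ∃ εs : ℝ, 0 < εs ∧ ∀ ε₀ : ℝ, 0 < ε₀ → ε₀ ≤ εs →
      ∀ α : Fin 4 → Fin 4 → Fin 4 → ℤ × ℤ × ℤ → ℝ, InTableClass R α →
        ∀ (νh : ℝ) (W : ℤ → ℝ → Em 4), IsEternalVisc ε₀ νh α W → UniformBound W →
          (∃ N : ℤ, ∀ k : ℤ, k ≤ N → ∀ σ : ℝ, W k σ = 0) → ¬ EternalSurvivingFwd 1 ε₀ W := by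
  intro R _hR
  exact ⟨1, one_pos, fun ε₀ hε _ α hα νh W hW hU ⟨N, hz⟩ =>
    not_survivingFwd_of_vanish_below hε hα hW hU hz⟩

/-- The unfed rung IS a case of the DECIDING crux K1ᵛ(1) `NoSurvivingEternalViscBddOne`.
[cite: Tao2016AveragedNS, §4 Thm. 4.2 (statement shape), §6.4; cell vocabulary] -/
theorem unfed_of_noSurvivingEternalViscBddOne (h : NoSurvivingEternalViscBddOne) :
    ∀ R : ℝ, 1 ≤ R → ∃ εs : ℝ, 0 < εs ∧ ∀ ε₀ : ℝ, 0 < ε₀ → ε₀ ≤ εs →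
      ∀ α : Fin 4 → Fin 4 → Fin 4 → ℤ × ℤ × ℤ → ℝ, InTableClass R α →
        ∀ (νh : ℝ) (W : ℤ → ℝ → Em 4), IsEternalVisc ε₀ νh α W → UniformBound W →
          (∃ N : ℤ, ∀ k : ℤ, k ≤ N → ∀ σ : ℝ, W k σ = 0) → ¬ EternalSurvivingFwd 1 ε₀ W := by
  intro R hR
  obtain ⟨εs, hεs, H⟩ := h R hR
  exact ⟨εs, hεs, fun ε₀ hε hle α hα νh W hW hU _ => H ε₀ hε hle α hα νh W hW hU⟩

end Summit.NavierStokesRegularity.NavierStokesRegularity.Theorems.NoSurvivingEternalViscBddOne.OneSided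

end
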